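import Summits.AtomisticToContinuum.FouriersLaw.Theorems.BondHeatUncertaintyBoundedResponseBathHeatOwedHeatPriceA
import HarnessLib

/-!
# BondHeatUncertainty / BoundedResponse — «OwedHeatPrice» §3–§4: POSITIVE PRICES (`(T1_{a,g}) ⟹ (OB_{a,g})`; `(DC_{a,α}) ⟹ (T1_{a,2−2α})`;
★★ `(T2⁸_a) ⟹ (T1_{a,1})`; `(DC_{a,1/2}) ⟹ (T2⁸_a)`; `(T2_{a,0}) ⟹ (T2⁸_a)`; the doors `(S) ∧ (T1_{a,g≤1}) / (T2⁸_a) / (DC_{a,α∈[1/2,1)}) ⟹ 11071`) and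
NEGATIVE PRICES (★★★ `(DF_{a,α≤1/2}) ⟹ ¬(T2_{a,0})` — NODE 115's window square budget is diffusive-false by a logarithm; `(DF_{a,α}) ⟹ ¬(T1_{a,g})` for
`g < 2 − 2α`; `(DF_{a,α}) ⟹ ¬(DC_{a,α'})` for `α' > α`)
(decomp-a2c lens-1, g116, NODE 116 «OwedHeatPrice»; part 2 of 3; imports part A; the light-cone door, the price table in one statement and the OVERVIEW
are in the main file `…BathHeatOwedHeatPrice`)

All doors hang beneath (S) through NODE 115's `boundedResponse_of_subdiffusiveBondHeat_lateOvershootBudget`.  The refutations instantiate the universally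
quantified statements at the parameter point `ω₂ = λ = β = γ = T = 1`.  No `sorry`, no new axioms; no new route statement in this file.
-/

noncomputable section

open MeasureTheory ProbabilityTheory Filter Topology Set Function
open scoped NNReal ENNReal
open Literature.MathematicalPhysics.KineticTheory.HeatConduction
open Literature.MathematicalPhysics.KineticTheory OscillatorChain
open Literature.Probability.Process
open Summit.AtomisticToContinuum.FouriersLaw.Theorems.SubdiffusiveBondHeat
open Summit.AtomisticToContinuum.FouriersLaw.Theorems.SubdiffusiveBondHeat.EscapeGrading
open Summit.AtomisticToContinuum.FouriersLaw.Theorems.BoundedResponse.TransientBand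

namespace Summit.AtomisticToContinuum.FouriersLaw.Theorems.BoundedResponse.HeatSpreading

open Summit.AtomisticToContinuum.FouriersLaw.Theses.BondHeatUncertainty (BoundedResponse SubdiffusiveBondHeat)

section Chain

variable {ω₂ lam β γ : ℝ} {T : ℝ}

/-! ## §3 POSITIVE PRICES: the sign-free suppliers of the residual and the grade each needs -/

/-- ★ **`(T1_{a,g}) ⟹ (OB_{a,g})`** (`a ≥ 0`): the late overshoot is at most the late total variation (`𝒯⁻ ≤ |𝒯|`). [this cell] -/
theorem lateOvershootBudget_of_lateVariationBudget {a g : ℝ} (ha : 0 ≤ a) (h : LateVariationBudget a g) :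
    LateOvershootBudget a g := by
  intro ω₂ lam β γ hω hl hβ hγ T hT c hc
  obtain ⟨C, N₀, hC⟩ := h ω₂ lam β γ hω hl hβ hγ T hT c hc
  obtain ⟨N₁, hN₁⟩ := eventually_lateWindow (a := a) (q := 1) hc N₀
  refine ⟨C, N₁, fun N hN => ?_⟩
  obtain ⟨hNN₀, hN1, hw⟩ := hN₁ N hN
  have hle : a * (N : ℝ) ≤ c * (N : ℝ) ^ 2 := by linarith
  have haN : (0:ℝ) ≤ a * N := by positivity
  have hI := intervalIntegrable_owedHeat hω hl hβ hγ hT N haN hle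
  have h1 : lateOvershoot ω₂ lam β γ T N (a * N) (c * (N : ℝ) ^ 2) ≤
      ∫ v in (a * N)..(c * (N : ℝ) ^ 2), |owedHeat ω₂ lam β γ T N v| := by
    unfold lateOvershoot
    exact intervalIntegral.integral_mono_on hle hI.2 hI.1.abs fun v _ => max_le (neg_le_abs _) (abs_nonneg _)
  have hγ2 : 0 ≤ γ ^ 2 := by positivity
  exact le_trans (mul_le_mul_of_nonneg_left h1 hγ2) (hC N hNN₀)

/-- ★★ **`(DC_{a,α}) ⟹ (T1_{a,2−2α})`** (`a > 0`, `α < 1`): integrate the ceiling, `∫_{aN}^{cN²}v^{−α}dv ≤ (cN²)^{1−α}/(1−α)`.  THE PRICE LINE: the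
late variation budget reaches the Ohmic grade `1` EXACTLY at the diffusive exponent `α = 1/2` — no exponent to spare. [this cell] -/
theorem lateVariationBudget_of_lateReturnCeiling {a α : ℝ} (ha : 0 < a) (hα : α < 1) (h : LateReturnCeiling a α) :
    LateVariationBudget a (2 - 2 * α) := by
  intro ω₂ lam β γ hω hl hβ hγ T hT c hc
  obtain ⟨A, N₀, hA⟩ := h ω₂ lam β γ hω hl hβ hγ T hT c hc
  obtain ⟨N₁, hN₁⟩ := eventually_lateWindow (a := a) (q := 1) hc N₀
  refine ⟨γ ^ 2 * (max A 0 * (c ^ (1 - α) / (1 - α))), N₁, fun N hN => ?_⟩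
  obtain ⟨hNN₀, hN1, hw⟩ := hN₁ N hN
  have hN0 : (0:ℝ) < N := by exact_mod_cast hN1
  have hle : a * (N : ℝ) ≤ c * (N : ℝ) ^ 2 := by linarith
  have haN : (0:ℝ) < a * N := by positivity
  have hcN : (0:ℝ) < c * (N : ℝ) ^ 2 := by positivity
  have hI := intervalIntegrable_owedHeat hω hl hβ hγ hT N haN.le hle
  have h1α : 0 < 1 - α := by linarith
  have hpt : ∀ v ∈ Icc (a * (N:ℝ)) (c * (N:ℝ) ^ 2), |owedHeat ω₂ lam β γ T N v| ≤ max A 0 * v ^ (-α) := fun v hv =>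
    (hA N hNN₀ v hv.1 hv.2).trans (mul_le_mul_of_nonneg_right (le_max_left _ _) (Real.rpow_nonneg (haN.le.trans hv.1) _))
  have hpow : IntervalIntegrable (fun v : ℝ => max A 0 * v ^ (-α)) volume (a * N) (c * (N:ℝ) ^ 2) :=
    (intervalIntegral.intervalIntegrable_rpow' (by linarith : (-1:ℝ) < -α)).const_mul (max A 0)
  have h1 : ∫ v in (a * N)..(c * (N : ℝ) ^ 2), |owedHeat ω₂ lam β γ T N v| ≤
      ∫ v in (a * N)..(c * (N : ℝ) ^ 2), max A 0 * v ^ (-α) :=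
    intervalIntegral.integral_mono_on hle hI.1.abs hpow hpt
  have h2 : ∫ v in (a * N)..(c * (N : ℝ) ^ 2), max A 0 * v ^ (-α) =
      max A 0 * (((c * (N:ℝ) ^ 2) ^ (-α + 1) - (a * N) ^ (-α + 1)) / (-α + 1)) := by
    rw [intervalIntegral.integral_const_mul, integral_rpow (Or.inl (by linarith))]
  have h3 : ((c * (N:ℝ) ^ 2) ^ (-α + 1) - (a * N) ^ (-α + 1)) / (-α + 1) ≤ (c * (N:ℝ) ^ 2) ^ (1 - α) / (1 - α) := by
    rw [show -α + 1 = 1 - α by ring]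
    exact div_le_div_of_nonneg_right (by linarith [Real.rpow_nonneg haN.le (1 - α)]) h1α.le
  have h4 : (c * (N:ℝ) ^ 2) ^ (1 - α) = c ^ (1 - α) * (N:ℝ) ^ (2 - 2 * α) := by
    rw [Real.mul_rpow hc.le (pow_nonneg hN0.le 2), ← Real.rpow_two, ← Real.rpow_mul hN0.le,
      show (2:ℝ) * (1 - α) = 2 - 2 * α by ring]
  have hA0 : 0 ≤ max A 0 := le_max_right _ _
  have hγ2 : 0 ≤ γ ^ 2 := by positivity
  calc γ ^ 2 * ∫ v in (a * N)..(c * (N : ℝ) ^ 2), |owedHeat ω₂ lam β γ T N v|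
      ≤ γ ^ 2 * (max A 0 * ((c * (N:ℝ) ^ 2) ^ (1 - α) / (1 - α))) := by
        refine mul_le_mul_of_nonneg_left (h1.trans ?_) hγ2
        rw [h2]
        exact mul_le_mul_of_nonneg_left h3 hA0
    _ = γ ^ 2 * (max A 0 * (c ^ (1 - α) / (1 - α))) * (N:ℝ) ^ (2 - 2 * α) := by rw [h4]; ring

/-- ★★ **`(T2⁸_a) ⟹ (T1_{a,1})`** (`a > 0`): cover `[aN, cN²]` by the dyadic blocks `[2^j aN, 2^{j+1} aN]`, `2^{j+1}aN ≤ 2cN²` (the octave budget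
is used at Thouless multiple `2c`), apply `dyadic_variation_le` and `√(2^k aN) ≤ √(2c)·N`. [this cell] -/
theorem lateVariationBudget_one_of_octaveSquareBudget {a : ℝ} (ha : 0 < a) (h : OctaveSquareBudget a) :
    LateVariationBudget a 1 := by
  intro ω₂ lam β γ hω hl hβ hγ T hT c hc
  obtain ⟨C, N₀, hC⟩ := h ω₂ lam β γ hω hl hβ hγ T hT (2 * c) (by linarith)
  obtain ⟨N₁, hN₁⟩ := eventually_lateWindow (a := a) (q := 1) hc N₀
  refine ⟨Real.sqrt (max C 0) * (Real.sqrt 2 + 1) * Real.sqrt (2 * c), N₁, fun N hN => ?_⟩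
  obtain ⟨hNN₀, hN1, hw⟩ := hN₁ N hN
  have hN0 : (0:ℝ) < N := by exact_mod_cast hN1
  have hle : a * (N : ℝ) ≤ c * (N : ℝ) ^ 2 := by linarith
  have haN : (0:ℝ) < a * N := by positivity
  have hoct : ∀ w : ℝ, a * N ≤ w → 2 * w ≤ 2 * c * (N:ℝ) ^ 2 →
      γ ^ 4 * ∫ u in w..(2 * w), owedHeat ω₂ lam β γ T N u ^ 2 ≤ max C 0 := fun w hw1 hw2 =>
    (hC N hNN₀ w hw1 (by linarith)).trans (le_max_left _ _)
  have hx : (1:ℝ) ≤ c * (N:ℝ) ^ 2 / (a * N) := by rw [le_div_iff₀ haN]; linarith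
  obtain ⟨n, hn1, hn2⟩ := exists_nat_pow_near hx (by norm_num : (1:ℝ) < 2)
  have hk1 : c * (N:ℝ) ^ 2 ≤ (2:ℝ) ^ (n + 1) * (a * N) := by
    rw [div_lt_iff₀ haN] at hn2; exact hn2.le
  have hk2 : (2:ℝ) ^ (n + 1) * (a * N) ≤ 2 * c * (N:ℝ) ^ 2 := by
    rw [le_div_iff₀ haN] at hn1; rw [pow_succ]; nlinarith
  have hD := dyadic_variation_le hω hl hβ hγ hT N haN (le_max_right C 0) hoct (n + 1) (a * N) le_rfl hk2
  have hIbig := (intervalIntegrable_owedHeat hω hl hβ hγ hT N haN.le (hle.trans hk1)).1.abs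
  have hmono : ∫ u in (a * N)..(c * (N:ℝ) ^ 2), |owedHeat ω₂ lam β γ T N u| ≤
      ∫ u in (a * N)..((2:ℝ) ^ (n + 1) * (a * N)), |owedHeat ω₂ lam β γ T N u| :=
    intervalIntegral.integral_mono_interval le_rfl hle hk1 (Eventually.of_forall fun u => abs_nonneg _) hIbig
  have hsq : Real.sqrt ((2:ℝ) ^ (n + 1) * (a * N)) ≤ Real.sqrt (2 * c) * N := by
    have h2c : 0 ≤ Real.sqrt (2 * c) * N := by positivity
    calc Real.sqrt ((2:ℝ) ^ (n + 1) * (a * N)) ≤ Real.sqrt ((Real.sqrt (2 * c) * N) ^ 2) := by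
          refine Real.sqrt_le_sqrt ?_
          rw [mul_pow, Real.sq_sqrt (by linarith : (0:ℝ) ≤ 2 * c)]
          linarith
      _ = Real.sqrt (2 * c) * N := Real.sqrt_sq h2c
  have hγ2 : 0 ≤ γ ^ 2 := by positivity
  rw [Real.rpow_one]
  calc γ ^ 2 * ∫ u in (a * N)..(c * (N:ℝ) ^ 2), |owedHeat ω₂ lam β γ T N u|
      ≤ γ ^ 2 * ∫ u in (a * N)..((2:ℝ) ^ (n + 1) * (a * N)), |owedHeat ω₂ lam β γ T N u| :=
        mul_le_mul_of_nonneg_left hmono hγ2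
    _ ≤ Real.sqrt (max C 0) * (Real.sqrt 2 + 1) * Real.sqrt ((2:ℝ) ^ (n + 1) * (a * N)) := hD
    _ ≤ Real.sqrt (max C 0) * (Real.sqrt 2 + 1) * (Real.sqrt (2 * c) * N) :=
        mul_le_mul_of_nonneg_left hsq (by positivity)
    _ = Real.sqrt (max C 0) * (Real.sqrt 2 + 1) * Real.sqrt (2 * c) * N := by ring

/-- ★ **`(DC_{a,1/2}) ⟹ (T2⁸_a)`** (`a > 0`) with `C = γ⁴A²`: on a block `[w,2w]`, `𝒯² ≤ A²u^{−1} ≤ A²/w` integrates to `A²` — the octave budget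
is CONSISTENT with the diffusive law (where the window budget `(T2_{a,0})` is not). [this cell] -/
theorem octaveSquareBudget_of_lateReturnCeiling_half {a : ℝ} (ha : 0 < a) (h : LateReturnCeiling a (1 / 2)) :
    OctaveSquareBudget a := by
  intro ω₂ lam β γ hω hl hβ hγ T hT c hc
  obtain ⟨A, N₀, hA⟩ := h ω₂ lam β γ hω hl hβ hγ T hT c hc
  obtain ⟨N₁, hN₁⟩ := eventually_lateWindow (a := a) (q := 1) hc N₀
  refine ⟨γ ^ 4 * (max A 0) ^ 2, N₁, fun N hN v hv h2v => ?_⟩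
  obtain ⟨hNN₀, hN1, hw⟩ := hN₁ N hN
  have hN0 : (0:ℝ) < N := by exact_mod_cast hN1
  have haN : (0:ℝ) < a * N := by positivity
  have hv0 : 0 < v := haN.trans_le hv
  have hv2 : v ≤ 2 * v := by linarith
  have hI := (intervalIntegrable_owedHeat hω hl hβ hγ hT N hv0.le hv2).1
  have hc' : ContinuousOn (owedHeat ω₂ lam β γ T N) (uIcc v (2 * v)) := by
    rw [uIcc_of_le hv2]
    exact (continuousOn_owedHeat hω hl hβ hγ hT N (by linarith)).mono (Icc_subset_Icc_left hv0.le)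
  have hpt : ∀ u ∈ Icc v (2 * v), owedHeat ω₂ lam β γ T N u ^ 2 ≤ (max A 0) ^ 2 / v := by
    intro u hu
    have hu0 : 0 < u := hv0.trans_le hu.1
    have h1 : |owedHeat ω₂ lam β γ T N u| ≤ max A 0 * u ^ (-(1/2:ℝ)) :=
      (hA N hNN₀ u (hv.trans hu.1) (hu.2.trans h2v)).trans
        (mul_le_mul_of_nonneg_right (le_max_left _ _) (Real.rpow_nonneg hu0.le _))
    have h2 : owedHeat ω₂ lam β γ T N u ^ 2 ≤ (max A 0 * u ^ (-(1/2:ℝ))) ^ 2 := by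
      rw [← sq_abs]; exact pow_le_pow_left₀ (abs_nonneg _) h1 2
    have h3 : (u ^ (-(1/2:ℝ))) ^ 2 = u⁻¹ := by
      rw [← Real.rpow_natCast, ← Real.rpow_mul hu0.le, show (-(1/2:ℝ)) * ((2:ℕ):ℝ) = -1 by norm_num, Real.rpow_neg_one]
    have h4 : u⁻¹ ≤ v⁻¹ := inv_anti₀ hv0 hu.1
    calc owedHeat ω₂ lam β γ T N u ^ 2 ≤ (max A 0) ^ 2 * u⁻¹ := by rw [mul_pow, h3] at h2; exact h2
      _ ≤ (max A 0) ^ 2 * v⁻¹ := mul_le_mul_of_nonneg_left h4 (sq_nonneg _)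
      _ = (max A 0) ^ 2 / v := (div_eq_mul_inv _ _).symm
  have h5 : ∫ u in v..(2 * v), owedHeat ω₂ lam β γ T N u ^ 2 ≤ ∫ u in v..(2 * v), (max A 0) ^ 2 / v :=
    intervalIntegral.integral_mono_on hv2 (hc'.pow 2).intervalIntegrable intervalIntegrable_const hpt
  rw [intervalIntegral.integral_const, smul_eq_mul, show (2 * v - v) * ((max A 0) ^ 2 / v) = (max A 0) ^ 2 by field_simp; ring] at h5
  exact mul_le_mul_of_nonneg_left h5 (by positivity)

/-- **`(T2_{a,0}) ⟹ (T2⁸_a)`** (`a ≥ 0`): NODE 115's window square budget trivially contains the octave budget (sub-interval of a non-negative integrand) —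
so the octave budget is WEAKER, and modulo the diffusive floor STRICTLY weaker (`not_lateOwedHeatSquareBudget_zero_of_lateReturnFloor` below kills the
window budget, `octaveSquareBudget_of_lateReturnCeiling_half` keeps the octave one). [this cell] -/
theorem octaveSquareBudget_of_lateOwedHeatSquareBudget_zero {a : ℝ} (ha : 0 ≤ a) (h : LateOwedHeatSquareBudget a 0) :
    OctaveSquareBudget a := by
  intro ω₂ lam β γ hω hl hβ hγ T hT c hc
  obtain ⟨C, N₀, hC⟩ := h ω₂ lam β γ hω hl hβ hγ T hT c hc
  refine ⟨C, N₀, fun N hN v hv h2v => ?_⟩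
  have haN : (0:ℝ) ≤ a * N := by positivity
  have hv0 : 0 ≤ v := haN.trans hv
  have hle : a * (N:ℝ) ≤ c * (N:ℝ) ^ 2 := hv.trans ((by linarith : v ≤ 2 * v).trans h2v)
  have hcont : ContinuousOn (owedHeat ω₂ lam β γ T N) (uIcc (a * N) (c * (N:ℝ) ^ 2)) := by
    rw [uIcc_of_le hle]
    exact (continuousOn_owedHeat hω hl hβ hγ hT N (haN.trans hle)).mono (Icc_subset_Icc_left haN)
  have hmono : ∫ u in v..(2 * v), owedHeat ω₂ lam β γ T N u ^ 2 ≤ ∫ u in (a * N)..(c * (N:ℝ) ^ 2), owedHeat ω₂ lam β γ T N u ^ 2 :=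
    intervalIntegral.integral_mono_interval hv (by linarith) h2v (Eventually.of_forall fun u => sq_nonneg _)
      (hcont.pow 2).intervalIntegrable
  have hbud := hC N hN
  rw [Real.rpow_zero, mul_one] at hbud
  exact (mul_le_mul_of_nonneg_left hmono (by positivity)).trans hbud

/-- ★★ **DOOR: (S) ∧ (T1_{a,g}) ⟹ 11071** (`a ≥ 0`, `g ≤ 1`). [this cell] -/
theorem boundedResponse_of_subdiffusiveBondHeat_lateVariationBudget {a g : ℝ} (ha : 0 ≤ a) (hg : g ≤ 1)
    (hS : SubdiffusiveBondHeat) (h : LateVariationBudget a g) : BoundedResponse :=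
  boundedResponse_of_subdiffusiveBondHeat_lateOvershootBudget ha hg hS (lateOvershootBudget_of_lateVariationBudget ha h)

/-- ★★ **DOOR: (S) ∧ (T2⁸_a) ⟹ 11071** (`a > 0`) — the corrected sign-free `L²` door. [this cell] -/
theorem boundedResponse_of_subdiffusiveBondHeat_octaveSquareBudget {a : ℝ} (ha : 0 < a)
    (hS : SubdiffusiveBondHeat) (h : OctaveSquareBudget a) : BoundedResponse :=
  boundedResponse_of_subdiffusiveBondHeat_lateVariationBudget ha.le le_rfl hS (lateVariationBudget_one_of_octaveSquareBudget ha h)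

/-- ★ **DOOR: (S) ∧ (DC_{a,α}) ⟹ 11071 for `1/2 ≤ α < 1`** (`a > 0`): the two-sided diffusive ceiling is a supplier exactly from the diffusive exponent on.
[this cell] -/
theorem boundedResponse_of_subdiffusiveBondHeat_lateReturnCeiling {a α : ℝ} (ha : 0 < a) (hα : 1 / 2 ≤ α) (hα1 : α < 1)
    (hS : SubdiffusiveBondHeat) (h : LateReturnCeiling a α) : BoundedResponse :=
  boundedResponse_of_subdiffusiveBondHeat_lateVariationBudget ha.le (by linarith) hS
    (lateVariationBudget_of_lateReturnCeiling ha hα1 h)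

/-! ## §4 NEGATIVE PRICES: what the diffusive floor refutes -/

/-- ★★★ **`(DF_{a,α}) ⟹ ¬(T2_{a,0})` for `α ≤ 1/2`** (`a > 0`): NODE 115's window square budget at grade `0` is DIFFUSIVE-FALSE —
`γ⁴∫_{aN}^{c₀N²}𝒯_N² ≥ γ⁴a₀²∫_{aN}^{c₀N²}dv/v = γ⁴a₀²·log(c₀N/a) → ∞` (at the parameter point `ω₂ = λ = β = γ = T = 1`, which the universally
quantified statements contain).  Corrects the tag of record «(T2_{a,0}) ATTACKABLE-M» (row 1570): the sign-free `L²` supplier must be the OCTAVE budget.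
[this cell] -/
theorem not_lateOwedHeatSquareBudget_zero_of_lateReturnFloor {a α : ℝ} (ha : 0 < a) (hα : α ≤ 1 / 2) (h : LateReturnFloor a α) :
    ¬ LateOwedHeatSquareBudget a 0 := by
  intro hT2
  obtain ⟨c₀, hc₀, a₀, ha₀, N₀, hF⟩ := h 1 1 1 1 one_pos one_pos one_pos one_pos 1 one_pos
  obtain ⟨C, N₂, hC⟩ := hT2 1 1 1 1 one_pos one_pos one_pos one_pos 1 one_pos c₀ hc₀
  obtain ⟨N₃, hN₃⟩ := exists_nat_log_window_ge ha hc₀ ((C + 1) / a₀ ^ 2)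
  obtain ⟨N₁, hN₁⟩ := eventually_lateWindow (a := a) (q := 1) hc₀ (max (max N₀ N₂) (max N₃ (Nat.ceil (1 / a))))
  obtain ⟨hNmax, hN1, hw⟩ := hN₁ N₁ le_rfl
  set N := N₁ with hNdef
  have hNN₀ : N₀ ≤ N := le_trans (le_max_left _ _) (le_trans (le_max_left _ _) hNmax)
  have hNN₂ : N₂ ≤ N := le_trans (le_max_right _ _) (le_trans (le_max_left _ _) hNmax)
  have hNN₃ : N₃ ≤ N := le_trans (le_max_left _ _) (le_trans (le_max_right _ _) hNmax)
  have hNa : Nat.ceil (1 / a) ≤ N := le_trans (le_max_right _ _) (le_trans (le_max_right _ _) hNmax)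
  have hN0 : (0:ℝ) < N := by exact_mod_cast hN1
  have hle : a * (N : ℝ) ≤ c₀ * (N : ℝ) ^ 2 := by linarith
  have haN : (0:ℝ) < a * N := by positivity
  have haN1 : (1:ℝ) ≤ a * N := by
    have : 1 / a ≤ (N:ℝ) := le_trans (Nat.le_ceil _) (by exact_mod_cast hNa)
    rw [div_le_iff₀ ha] at this; linarith
  -- pointwise: `a₀²·v⁻¹ ≤ 𝒯_N(v)²` on the window
  have hpt : ∀ v ∈ Icc (a * (N:ℝ)) (c₀ * (N:ℝ) ^ 2), a₀ ^ 2 * v⁻¹ ≤ owedHeat 1 1 1 1 1 N v ^ 2 := by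
    intro v hv
    have hv1 : 1 ≤ v := haN1.trans hv.1
    have hv0 : 0 < v := by linarith
    have h1 : a₀ * v ^ (-α) ≤ owedHeat 1 1 1 1 1 N v := hF N hNN₀ v hv.1 hv.2
    have h2 : v ^ (-(1/2:ℝ)) ≤ v ^ (-α) := Real.rpow_le_rpow_of_exponent_le hv1 (by linarith)
    have h3 : a₀ * v ^ (-(1/2:ℝ)) ≤ owedHeat 1 1 1 1 1 N v := (mul_le_mul_of_nonneg_left h2 ha₀.le).trans h1
    have h4 : 0 ≤ a₀ * v ^ (-(1/2:ℝ)) := mul_nonneg ha₀.le (Real.rpow_nonneg hv0.le _)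
    have h5 : (a₀ * v ^ (-(1/2:ℝ))) ^ 2 ≤ owedHeat 1 1 1 1 1 N v ^ 2 := pow_le_pow_left₀ h4 h3 2
    have h6 : (v ^ (-(1/2:ℝ))) ^ 2 = v⁻¹ := by
      rw [← Real.rpow_natCast, ← Real.rpow_mul hv0.le, show (-(1/2:ℝ)) * ((2:ℕ):ℝ) = -1 by norm_num, Real.rpow_neg_one]
    rw [mul_pow, h6] at h5
    exact h5
  have hcont : ContinuousOn (owedHeat 1 1 1 1 1 N) (uIcc (a * N) (c₀ * (N:ℝ) ^ 2)) := by
    rw [uIcc_of_le hle]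
    exact (continuousOn_owedHeat one_pos one_pos one_pos one_pos one_pos N (haN.le.trans hle)).mono (Icc_subset_Icc_left haN.le)
  have hinvI : IntervalIntegrable (fun v : ℝ => a₀ ^ 2 * v⁻¹) volume (a * N) (c₀ * (N:ℝ) ^ 2) := by
    refine (intervalIntegral.intervalIntegrable_inv (fun x hx => ?_) continuousOn_id).const_mul (a₀ ^ 2)
    rw [uIcc_of_le hle] at hx
    exact ne_of_gt (haN.trans_le hx.1)
  have hlow : ∫ v in (a * N)..(c₀ * (N:ℝ) ^ 2), a₀ ^ 2 * v⁻¹ ≤ ∫ v in (a * N)..(c₀ * (N:ℝ) ^ 2), owedHeat 1 1 1 1 1 N v ^ 2 :=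
    intervalIntegral.integral_mono_on hle hinvI (hcont.pow 2).intervalIntegrable hpt
  have hval : ∫ v in (a * N)..(c₀ * (N:ℝ) ^ 2), a₀ ^ 2 * v⁻¹ = a₀ ^ 2 * Real.log (c₀ * (N:ℝ) / a) := by
    rw [intervalIntegral.integral_const_mul, integral_inv_of_pos haN (haN.trans_le hle)]
    congr 2
    field_simp
  have hlog : (C + 1) / a₀ ^ 2 ≤ Real.log (c₀ * (N:ℝ) / a) := hN₃ N hNN₃
  have ha2 : 0 < a₀ ^ 2 := by positivity
  have hbig : C + 1 ≤ a₀ ^ 2 * Real.log (c₀ * (N:ℝ) / a) := by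
    rw [div_le_iff₀ ha2] at hlog; linarith
  have hbud := hC N hNN₂
  rw [Real.rpow_zero, mul_one, one_pow, one_mul] at hbud
  linarith

/-- ★★ **`(DF_{a,α}) ⟹ ¬(T1_{a,g})` for `g < 2 − 2α`** (`a > 0`, `0 ≤ α`): `∫_{aN}^{c₀N²}|𝒯| ≥ (c₀N²/2)·a₀(c₀N²)^{−α}` — the variation budget is
FALSE below its diffusive grade; at `α = 1/2` every `g < 1` is refuted, so `(T1_{a,1})` is exponent-CRITICAL. [this cell] -/
theorem not_lateVariationBudget_of_lateReturnFloor {a α g : ℝ} (ha : 0 < a) (hα0 : 0 ≤ α) (hg : g < 2 - 2 * α)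
    (h : LateReturnFloor a α) : ¬ LateVariationBudget a g := by
  intro hT1
  obtain ⟨c₀, hc₀, a₀, ha₀, N₀, hF⟩ := h 1 1 1 1 one_pos one_pos one_pos one_pos 1 one_pos
  obtain ⟨C, N₂, hC⟩ := hT1 1 1 1 1 one_pos one_pos one_pos one_pos 1 one_pos c₀ hc₀
  have hκ : 0 < a₀ / 2 * c₀ ^ (1 - α) := by positivity
  obtain ⟨N₃, hN₃⟩ := exists_nat_rpow_dominate hg hκ C
  obtain ⟨N₁, hN₁⟩ := eventually_lateWindow (a := a) (q := 2) hc₀ (max (max N₀ N₂) N₃)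
  obtain ⟨hNmax, hN1, hw⟩ := hN₁ N₁ le_rfl
  set N := N₁ with hNdef
  have hNN₀ : N₀ ≤ N := le_trans (le_max_left _ _) (le_trans (le_max_left _ _) hNmax)
  have hNN₂ : N₂ ≤ N := le_trans (le_max_right _ _) (le_trans (le_max_left _ _) hNmax)
  have hNN₃ : N₃ ≤ N := le_trans (le_max_right _ _) hNmax
  have hN0 : (0:ℝ) < N := by exact_mod_cast hN1
  have haN : (0:ℝ) < a * N := by positivity
  have hcN : (0:ℝ) < c₀ * (N:ℝ) ^ 2 := by positivity
  have hle : a * (N : ℝ) ≤ c₀ * (N : ℝ) ^ 2 := by linarith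
  -- pointwise: `a₀ (c₀N²)^{−α} ≤ |𝒯_N(v)|` on the window
  have hpt : ∀ v ∈ Icc (a * (N:ℝ)) (c₀ * (N:ℝ) ^ 2), a₀ * (c₀ * (N:ℝ) ^ 2) ^ (-α) ≤ |owedHeat 1 1 1 1 1 N v| := by
    intro v hv
    have hv0 : 0 < v := haN.trans_le hv.1
    have h1 : a₀ * v ^ (-α) ≤ owedHeat 1 1 1 1 1 N v := hF N hNN₀ v hv.1 hv.2
    have h2 : (c₀ * (N:ℝ) ^ 2) ^ (-α) ≤ v ^ (-α) := Real.rpow_le_rpow_of_nonpos hv0 hv.2 (by linarith)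
    exact ((mul_le_mul_of_nonneg_left h2 ha₀.le).trans h1).trans (le_abs_self _)
  have hcont : ContinuousOn (owedHeat 1 1 1 1 1 N) (uIcc (a * N) (c₀ * (N:ℝ) ^ 2)) := by
    rw [uIcc_of_le hle]
    exact (continuousOn_owedHeat one_pos one_pos one_pos one_pos one_pos N (haN.le.trans hle)).mono (Icc_subset_Icc_left haN.le)
  have hlow : ∫ v in (a * N)..(c₀ * (N:ℝ) ^ 2), a₀ * (c₀ * (N:ℝ) ^ 2) ^ (-α) ≤
      ∫ v in (a * N)..(c₀ * (N:ℝ) ^ 2), |owedHeat 1 1 1 1 1 N v| :=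
    intervalIntegral.integral_mono_on hle intervalIntegrable_const hcont.intervalIntegrable.abs hpt
  rw [intervalIntegral.integral_const, smul_eq_mul] at hlow
  have hhalf : c₀ * (N:ℝ) ^ 2 / 2 ≤ c₀ * (N:ℝ) ^ 2 - a * N := by linarith
  have hpos : 0 ≤ a₀ * (c₀ * (N:ℝ) ^ 2) ^ (-α) := mul_nonneg ha₀.le (Real.rpow_nonneg hcN.le _)
  have hlow2 : c₀ * (N:ℝ) ^ 2 / 2 * (a₀ * (c₀ * (N:ℝ) ^ 2) ^ (-α)) ≤ ∫ v in (a * N)..(c₀ * (N:ℝ) ^ 2), |owedHeat 1 1 1 1 1 N v| :=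
    (mul_le_mul_of_nonneg_right hhalf hpos).trans hlow
  have hid : c₀ * (N:ℝ) ^ 2 / 2 * (a₀ * (c₀ * (N:ℝ) ^ 2) ^ (-α)) = a₀ / 2 * c₀ ^ (1 - α) * (N:ℝ) ^ (2 - 2 * α) := by
    have e1 : c₀ * (N:ℝ) ^ 2 * (c₀ * (N:ℝ) ^ 2) ^ (-α) = (c₀ * (N:ℝ) ^ 2) ^ (1 - α) := by
      rw [show (1:ℝ) - α = 1 + -α by ring, Real.rpow_add hcN, Real.rpow_one]
    have e2 : (c₀ * (N:ℝ) ^ 2) ^ (1 - α) = c₀ ^ (1 - α) * (N:ℝ) ^ (2 - 2 * α) := by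
      rw [Real.mul_rpow hc₀.le (pow_nonneg hN0.le 2), ← Real.rpow_two, ← Real.rpow_mul hN0.le,
        show (2:ℝ) * (1 - α) = 2 - 2 * α by ring]
    calc c₀ * (N:ℝ) ^ 2 / 2 * (a₀ * (c₀ * (N:ℝ) ^ 2) ^ (-α))
        = a₀ / 2 * (c₀ * (N:ℝ) ^ 2 * (c₀ * (N:ℝ) ^ 2) ^ (-α)) := by ring
      _ = a₀ / 2 * c₀ ^ (1 - α) * (N:ℝ) ^ (2 - 2 * α) := by rw [e1, e2]; ring
  have hbud := hC N hNN₂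
  rw [one_pow, one_mul] at hbud
  have hdom := hN₃ N hNN₃
  linarith

/-- ★ **`(DF_{a,α}) ⟹ ¬(DC_{a,α'})` for `α' > α`**: the floor pins the exponent of any ceiling — at `v = c₀N²`, `a₀v^{−α} ≤ A v^{−α'}` fails
for large `N`. [this cell] -/
theorem not_lateReturnCeiling_of_lateReturnFloor {a α α' : ℝ} (hαα' : α < α') (h : LateReturnFloor a α) :
    ¬ LateReturnCeiling a α' := by
  intro hC'
  obtain ⟨c₀, hc₀, a₀, ha₀, N₀, hF⟩ := h 1 1 1 1 one_pos one_pos one_pos one_pos 1 one_pos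
  obtain ⟨A, N₂, hA⟩ := hC' 1 1 1 1 one_pos one_pos one_pos one_pos 1 one_pos c₀ hc₀
  -- `A·x^{−α'} < a₀·x^{−α}` for large `x`; take `x = c₀N²` via the natural-number lemma applied to exponents `−2α' < −2α`
  have hκ : 0 < a₀ * c₀ ^ (-α) := by positivity
  obtain ⟨N₃, hN₃⟩ := exists_nat_rpow_dominate (show -2 * α' < -2 * α by linarith) hκ (max A 0 * c₀ ^ (-α'))
  obtain ⟨N₁, hN₁⟩ := eventually_lateWindow (a := a) (q := 1) hc₀ (max (max N₀ N₂) N₃)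
  obtain ⟨hNmax, hN1, hw⟩ := hN₁ N₁ le_rfl
  set N := N₁ with hNdef
  have hNN₀ : N₀ ≤ N := le_trans (le_max_left _ _) (le_trans (le_max_left _ _) hNmax)
  have hNN₂ : N₂ ≤ N := le_trans (le_max_right _ _) (le_trans (le_max_left _ _) hNmax)
  have hNN₃ : N₃ ≤ N := le_trans (le_max_right _ _) hNmax
  have hN0 : (0:ℝ) < N := by exact_mod_cast hN1
  have hcN : (0:ℝ) < c₀ * (N:ℝ) ^ 2 := by positivity
  have hle : a * (N : ℝ) ≤ c₀ * (N : ℝ) ^ 2 := by linarith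
  have h1 : a₀ * (c₀ * (N:ℝ) ^ 2) ^ (-α) ≤ owedHeat 1 1 1 1 1 N (c₀ * (N:ℝ) ^ 2) := hF N hNN₀ _ hle le_rfl
  have h2 : |owedHeat 1 1 1 1 1 N (c₀ * (N:ℝ) ^ 2)| ≤ max A 0 * (c₀ * (N:ℝ) ^ 2) ^ (-α') :=
    (hA N hNN₂ _ hle le_rfl).trans (mul_le_mul_of_nonneg_right (le_max_left _ _) (Real.rpow_nonneg hcN.le _))
  have e : ∀ e : ℝ, (c₀ * (N:ℝ) ^ 2) ^ (-e) = c₀ ^ (-e) * (N:ℝ) ^ (-2 * e) := fun e => by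
    rw [Real.mul_rpow hc₀.le (pow_nonneg hN0.le 2), ← Real.rpow_two, ← Real.rpow_mul hN0.le,
      show (2:ℝ) * -e = -2 * e by ring]
  rw [e] at h1 h2
  have hdom := hN₃ N hNN₃
  have h3 := h1.trans ((le_abs_self _).trans h2)
  nlinarith [h3, hdom]

end Chain

end Summit.AtomisticToContinuum.FouriersLaw.Theorems.BoundedResponse.HeatSpreading

end
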